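import Summits.CriticalPhenomena.PercolationContinuityZ3.Theorems.Transplant.FKDoubleFanMultifanCone
import HarnessLib

/-!
# Double fans `K₂ ∨ P_{m+1}`: the SIGN ORTHANT of the MULTIFAN₁ images — certificates A (`xv ≥ 0`, `uz ≤ 0`, `yz ≤ 0`, `uy ≥ 0`)

Helper file (`--supports stmt-CriticalPhenomena-4575`), FK sub-lane `prim-bschramm-fk-3` (gen 44); builds on p205010 (kernel theorem, internal
audit signed; external expert review pending).  No named facts, no sorries; standard axioms.  Memo `bschramm/prim-bschramm-fk-3/FAR-CROSS-XIX.md` §2g.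

Mirror of `…OneSidedConeSSignsCertA/B/C` (gen 39, `a`-images) and `…TwoSidedSignsBCertA–D` (gen 41, `b`-images) for the MULTIFAN₁ images
`imgAB q F G u` of `…MultifanCone` (`a`-gadget `F`, then `b`-gadget `G`, input `u`): for `F, G, u` with the eight `Valid` inequalities (`0 ≤ q ≤ 1`)
the hat–Plücker coordinates have the same fixed signs as the single-fan images (`ux, uy, uv, xv, yv, zv ≥ 0`, `uz, xz, yz ≤ 0`, `xy` free; exact
census of the memo: 0/2383 violations, also `|coord| ≤ ℓ` and `ℓ_D ≥ 0`).  This file proves the four smallest ones as explicit q-PARAMETRIC identities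
`= Σ c_j · (1−q)^i q^j (2−q)^k · (valid form of F) · (valid form of G) · (valid form of u)`, `c_j ≥ 0` rational (product-form LP over the 10 648
trilinear products of the 22 valid forms per leg × 10 `q`-monomials, kit j294716, exact rational verification): **`imgAB_xv_nonneg`** (9 terms — the
`∧²V₂`-coordinate FACTORISES: `(imgAB)_xv = N^{ac}(F)·N^{ac}(G)·ψ_q(u)`), **`imgAB_uz_nonpos`** (31), **`imgAB_yz_nonpos`** (25), **`imgAB_uy_nonneg`** (36).
Together with `C3` (`…Blocks`) these are the first unconditional linear constraints on the MULTIFAN₁ cone; the remaining signs and the sup-norm bound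
`‖imgAB‖_∞ ≤ ℓ(imgAB)` (needed for the positivity functional `e₀` of `hypAC_of_crossPosA`, `…MultifanConeCross`) have certificates of 100–430 terms
(memo §2g) and are left to follow-up files.
[folklore]
-/

noncomputable section

namespace Summit.CriticalPhenomena.PercolationContinuityZ3.Theorems

namespace FK

namespace ThreeApex

/-- `(imgAB)_xv ≥ 0` for the MULTIFAN₁ image: the certificate identity (9 terms, non-negative combination of `q`-factors and valid forms of the
three legs; product-form LP, kit j294716, exact rational verification). [folklore] -/
theorem imgAB_xv_nonneg_eq (q : ℝ) (F G u : V5) :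
    (imgAB q F G u).xv =
      (1 : ℝ) * masterN q F * masterN q G * (u.z0 * u.zbc)
      + (1 : ℝ) * masterN q F * masterN q G * masterN q (swapBC u)
      + (1 : ℝ) / 2 * (2 - q) * masterN q F * masterN q G * (u.z0 * u.z0)
      + (1 : ℝ) / 2 * (2 - q) * masterN q F * masterN q G * (u.z0 * u.zac)
      + (1 : ℝ) / 2 * (2 - q) * masterN q F * masterN q G * (u.zac * u.zbc)
      + (1 : ℝ) * (2 - q) * masterN q F * masterN q G * kap (swapBC u)
      + (1 : ℝ) / 2 * q * masterN q F * masterN q G * (u.z0 * u.z0)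
      + (1 : ℝ) / 2 * q * masterN q F * masterN q G * (u.z0 * u.zac)
      + (1 : ℝ) / 2 * q * masterN q F * masterN q G * (u.zac * u.zbc) := by
  simp only [imgAB, wedgeH, fanComboB, fanCombo, conv, edgeAC, edgeBC, detach, V5.total, hx, hy, hz, masterN, kap, swapBC]
  ring

/-- `(imgAB)_xv ≥ 0` for every MULTIFAN₁ image over `Valid³` (`0 ≤ q ≤ 1`). [folklore] -/
theorem imgAB_xv_nonneg {q : ℝ} {F G u : V5} (hq0 : 0 ≤ q) (hq1 : q ≤ 1) (hF : Valid q F) (hG : Valid q G) (hu : Valid q u) :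
    0 ≤ (imgAB q F G u).xv := by
  obtain ⟨⟨hF0, hFab, hFac, hFbc, hF1⟩, hFN, hFNab, hFNbc, hFL, hFk, hFkb, hFkc⟩ := hF
  obtain ⟨⟨hG0, hGab, hGac, hGbc, hG1⟩, hGN, hGNab, hGNbc, hGL, hGk, hGkb, hGkc⟩ := hG
  obtain ⟨⟨hu0, huab, huac, hubc, hu1⟩, huN, huNab, huNbc, huL, huk, hukb, hukc⟩ := hu
  have hp : 0 ≤ 1 - q := by linarith
  have hr : 0 ≤ 2 - q := by linarith
  rw [imgAB_xv_nonneg_eq]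
  positivity

/-- `−(imgAB)_uz ≥ 0` for the MULTIFAN₁ image: the certificate identity (31 terms, non-negative combination of `q`-factors and valid forms of the
three legs; product-form LP, kit j294716, exact rational verification). [folklore] -/
theorem imgAB_uz_nonpos_eq (q : ℝ) (F G u : V5) :
    -(imgAB q F G u).uz =
      (1 : ℝ) * (F.zab * F.zac) * masterN q G * (u.z0 * u.zbc)
      + (1 : ℝ) * (F.zac * F.zac) * kap G * (u.z0 * u.zbc)
      + (1 : ℝ) * (F.zac * F.z1) * kap G * (u.z0 * u.zbc)
      + (1 : ℝ) * masterN q F * (G.zab * G.zac) * (u.z0 * u.z0)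
      + (1 : ℝ) * masterN q F * lam G * (u.z0 * u.z0)
      + (1 : ℝ) * kap F * (G.zab * G.zac) * (u.z0 * u.zbc)
      + (1 : ℝ) * kap F * lam G * (u.zac * u.zbc)
      + (1 : ℝ) / 2 * (2 - q) * (F.z0 * F.zac) * masterN q G * (u.z0 * u.zbc)
      + (1 : ℝ) / 2 * (2 - q) * (F.z0 * F.zac) * masterN q G * (u.zac * u.zbc)
      + (1 : ℝ) / 2 * (2 - q) * (F.zab * F.zac) * masterN q G * (u.zac * u.zbc)
      + (1 : ℝ) / 2 * (2 - q) * (F.zac * F.zac) * kap G * (u.zac * u.zbc)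
      + (1 : ℝ) / 2 * (2 - q) * (F.zac * F.zbc) * kap G * (u.z0 * u.zbc)
      + (1 : ℝ) / 2 * (2 - q) * (F.zac * F.zbc) * kap G * (u.zac * u.zbc)
      + (1 : ℝ) / 2 * (2 - q) * (F.zac * F.z1) * kap G * (u.zac * u.zbc)
      + (1 : ℝ) / 2 * (2 - q) * masterN q F * (G.zab * G.zac) * (u.z0 * u.zac)
      + (1 : ℝ) / 2 * (2 - q) * masterN q F * lam G * (u.z0 * u.zac)
      + (1 : ℝ) / 2 * (2 - q) * kap F * (G.zab * G.zac) * (u.zac * u.zbc)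
      + (1 : ℝ) / 2 * (2 - q) * kap F * lam G * (u.z0 * u.zbc)
      + (1 : ℝ) / 2 * q * (F.z0 * F.zac) * masterN q G * (u.z0 * u.zbc)
      + (1 : ℝ) / 2 * q * (F.z0 * F.zac) * masterN q G * (u.zac * u.zbc)
      + (1 : ℝ) / 2 * q * (F.zab * F.zac) * masterN q G * (u.zac * u.zbc)
      + (1 : ℝ) / 2 * q * (F.zac * F.zac) * kap G * (u.zac * u.zbc)
      + (1 : ℝ) / 2 * q * (F.zac * F.zbc) * kap G * (u.z0 * u.zbc)
      + (1 : ℝ) / 2 * q * (F.zac * F.zbc) * kap G * (u.zac * u.zbc)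
      + (1 : ℝ) / 2 * q * (F.zac * F.z1) * kap G * (u.zac * u.zbc)
      + (1 : ℝ) / 2 * q * masterN q F * (G.zab * G.zac) * (u.z0 * u.zac)
      + (1 : ℝ) / 2 * q * masterN q F * lam G * (u.z0 * u.zac)
      + (1 : ℝ) / 4 * q * (2 - q) * kap F * (G.zab * G.zac) * (u.zac * u.zbc)
      + (1 : ℝ) / 4 * q * (2 - q) * kap F * lam G * (u.z0 * u.zbc)
      + (1 : ℝ) / 4 * q ^ 2 * kap F * (G.zab * G.zac) * (u.zac * u.zbc)
      + (1 : ℝ) / 4 * q ^ 2 * kap F * lam G * (u.z0 * u.zbc) := by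
  simp only [imgAB, wedgeH, fanComboB, fanCombo, conv, edgeAC, edgeBC, detach, V5.total, hx, hy, hz, masterN, kap, lam]
  ring

/-- `−(imgAB)_uz ≥ 0` for every MULTIFAN₁ image over `Valid³` (`0 ≤ q ≤ 1`). [folklore] -/
theorem imgAB_uz_nonpos {q : ℝ} {F G u : V5} (hq0 : 0 ≤ q) (hq1 : q ≤ 1) (hF : Valid q F) (hG : Valid q G) (hu : Valid q u) :
    0 ≤ -(imgAB q F G u).uz := by
  obtain ⟨⟨hF0, hFab, hFac, hFbc, hF1⟩, hFN, hFNab, hFNbc, hFL, hFk, hFkb, hFkc⟩ := hF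
  obtain ⟨⟨hG0, hGab, hGac, hGbc, hG1⟩, hGN, hGNab, hGNbc, hGL, hGk, hGkb, hGkc⟩ := hG
  obtain ⟨⟨hu0, huab, huac, hubc, hu1⟩, huN, huNab, huNbc, huL, huk, hukb, hukc⟩ := hu
  have hp : 0 ≤ 1 - q := by linarith
  have hr : 0 ≤ 2 - q := by linarith
  rw [imgAB_uz_nonpos_eq]
  positivity

/-- `−(imgAB)_yz ≥ 0` for the MULTIFAN₁ image: the certificate identity (25 terms, non-negative combination of `q`-factors and valid forms of the
three legs; product-form LP, kit j294716, exact rational verification). [folklore] -/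
theorem imgAB_yz_nonpos_eq (q : ℝ) (F G u : V5) :
    -(imgAB q F G u).yz =
      (1 : ℝ) * masterN q F * masterN q G * (u.z0 * u.z0)
      + (1 : ℝ) * masterN q F * masterN q G * (u.z0 * u.zbc)
      + (1 : ℝ) * masterN q F * masterN q G * (u.zac * u.zbc)
      + (1 : ℝ) * (2 - q) * (F.zac * F.zbc) * kap G * (u.z0 * u.zbc)
      + (1 : ℝ) * (2 - q) * (F.zac * F.zbc) * kap G * (u.zac * u.zbc)
      + (1 : ℝ) * (2 - q) * (F.zac * F.z1) * kap G * (u.z0 * u.zbc)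
      + (1 : ℝ) * (2 - q) * (F.zac * F.z1) * kap G * (u.zac * u.zbc)
      + (1 : ℝ) * (2 - q) * masterN q F * (G.zab * G.zac) * (u.z0 * u.z0)
      + (1 : ℝ) * (2 - q) * masterN q F * (G.zab * G.zac) * (u.z0 * u.zac)
      + (1 : ℝ) * (2 - q) * masterN q F * lam G * (u.z0 * u.z0)
      + (1 : ℝ) * (2 - q) * kap F * (G.zab * G.zac) * (u.z0 * u.zbc)
      + (1 : ℝ) * (2 - q) * kap F * (G.zab * G.zac) * (u.zac * u.zbc)
      + (1 : ℝ) * (2 - q) * kap F * masterN q G * (u.z0 * u.zbc)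
      + (1 : ℝ) * (2 - q) * kap F * masterN q G * (u.zac * u.zbc)
      + (1 : ℝ) * (2 - q) * kap F * lam G * (u.z0 * u.zbc)
      + (1 : ℝ) * (2 - q) * kap F * lam G * (u.zac * u.zbc)
      + (1 : ℝ) / 2 * (2 - q) ^ 2 * (F.zac * F.zac) * kap G * (u.z0 * u.zbc)
      + (1 : ℝ) / 2 * (2 - q) ^ 2 * (F.zac * F.zac) * kap G * (u.zac * u.zbc)
      + (1 : ℝ) / 4 * (2 - q) ^ 2 * masterN q F * masterN q G * (u.z0 * u.zac)
      + (1 : ℝ) / 2 * (2 - q) ^ 2 * masterN q F * lam G * (u.z0 * u.zac)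
      + (1 : ℝ) / 2 * q * masterN q F * masterN q G * (u.z0 * u.zac)
      + (1 : ℝ) / 2 * q * (2 - q) * (F.zac * F.zac) * kap G * (u.z0 * u.zbc)
      + (1 : ℝ) / 2 * q * (2 - q) * (F.zac * F.zac) * kap G * (u.zac * u.zbc)
      + (1 : ℝ) / 4 * q * (2 - q) * masterN q F * masterN q G * (u.z0 * u.zac)
      + (1 : ℝ) / 2 * q * (2 - q) * masterN q F * lam G * (u.z0 * u.zac) := by
  simp only [imgAB, wedgeH, fanComboB, fanCombo, conv, edgeAC, edgeBC, detach, V5.total, hx, hy, hz, masterN, kap, lam]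
  ring

/-- `−(imgAB)_yz ≥ 0` for every MULTIFAN₁ image over `Valid³` (`0 ≤ q ≤ 1`). [folklore] -/
theorem imgAB_yz_nonpos {q : ℝ} {F G u : V5} (hq0 : 0 ≤ q) (hq1 : q ≤ 1) (hF : Valid q F) (hG : Valid q G) (hu : Valid q u) :
    0 ≤ -(imgAB q F G u).yz := by
  obtain ⟨⟨hF0, hFab, hFac, hFbc, hF1⟩, hFN, hFNab, hFNbc, hFL, hFk, hFkb, hFkc⟩ := hF
  obtain ⟨⟨hG0, hGab, hGac, hGbc, hG1⟩, hGN, hGNab, hGNbc, hGL, hGk, hGkb, hGkc⟩ := hG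
  obtain ⟨⟨hu0, huab, huac, hubc, hu1⟩, huN, huNab, huNbc, huL, huk, hukb, hukc⟩ := hu
  have hp : 0 ≤ 1 - q := by linarith
  have hr : 0 ≤ 2 - q := by linarith
  rw [imgAB_yz_nonpos_eq]
  positivity

/-- `(imgAB)_uy ≥ 0` for the MULTIFAN₁ image: the certificate identity (36 terms, non-negative combination of `q`-factors and valid forms of the
three legs; product-form LP, kit j294716, exact rational verification). [folklore] -/
theorem imgAB_uy_nonneg_eq (q : ℝ) (F G u : V5) :
    (imgAB q F G u).uy =
      (1 : ℝ) * (F.zac * F.zbc) * (G.z0 * G.zac) * (u.z0 * u.zbc)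
      + (1 : ℝ) * (F.zac * F.zbc) * (G.zab * G.zac) * (u.z0 * u.zbc)
      + (1 : ℝ) * (F.zac * F.zbc) * (G.zab * G.zac) * (u.zac * u.zbc)
      + (1 : ℝ) * masterN q F * (G.z0 * G.zac) * (u.z0 * u.zbc)
      + (1 : ℝ) * masterN q F * (G.z0 * G.zac) * (u.zac * u.zbc)
      + (1 : ℝ) / 2 * masterN q F * (G.zab * G.zac) * (u.z0 * u.zbc)
      + (1 : ℝ) / 2 * masterN q F * (G.zab * G.zac) * (u.zac * u.zbc)
      + (1 : ℝ) * masterN q F * (G.zac * G.zac) * (u.z0 * u.z0)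
      + (1 : ℝ) * masterN q F * (G.zac * G.zac) * (u.z0 * u.zac)
      + (1 : ℝ) * lam F * (G.z0 * G.zac) * (u.z0 * u.zbc)
      + (1 : ℝ) / 2 * lam F * (G.zab * G.zac) * (u.z0 * u.zbc)
      + (1 : ℝ) * kap F * (G.zac * G.zac) * (u.zac * u.zbc)
      + (1 : ℝ) / 2 * (2 - q) * (F.zac * F.zbc) * (G.z0 * G.zac) * (u.zac * u.zbc)
      + (1 : ℝ) / 2 * (2 - q) * masterN q F * (G.zab * G.zac) * (u.z0 * u.z0)
      + (1 : ℝ) / 2 * (2 - q) * masterN q F * (G.zab * G.zac) * (u.z0 * u.zac)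
      + (1 : ℝ) / 4 * (2 - q) * masterN q F * (G.zab * G.zac) * (u.z0 * u.zbc)
      + (1 : ℝ) / 4 * (2 - q) * masterN q F * (G.zab * G.zac) * (u.zac * u.zbc)
      + (1 : ℝ) / 2 * (2 - q) * lam F * (G.z0 * G.zac) * (u.zac * u.zbc)
      + (1 : ℝ) / 4 * (2 - q) * lam F * (G.zab * G.zac) * (u.z0 * u.zbc)
      + (1 : ℝ) / 2 * (2 - q) * lam F * (G.zab * G.zac) * (u.zac * u.zbc)
      + (1 : ℝ) / 2 * (2 - q) * kap F * (G.zac * G.zac) * (u.z0 * u.zbc)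
      + (1 : ℝ) / 4 * (2 - q) ^ 2 * kap F * (G.zab * G.zac) * (u.z0 * u.zbc)
      + (1 : ℝ) / 4 * (2 - q) ^ 2 * kap F * (G.zab * G.zac) * (u.zac * u.zbc)
      + (1 : ℝ) / 4 * q * (F.zac * F.zac) * (G.zab * G.zac) * (u.z0 * u.zbc)
      + (1 : ℝ) / 4 * q * (F.zac * F.zac) * (G.zab * G.zac) * (u.zac * u.zbc)
      + (1 : ℝ) / 2 * q * (F.zac * F.zbc) * (G.z0 * G.zac) * (u.zac * u.zbc)
      + (1 : ℝ) / 4 * q * (F.zac * F.z1) * (G.zab * G.zac) * (u.zac * u.zbc)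
      + (1 : ℝ) * q * masterN q F * (G.z0 * G.zac) * (u.z0 * u.z0)
      + (1 : ℝ) * q * masterN q F * (G.z0 * G.zac) * (u.z0 * u.zac)
      + (1 : ℝ) / 2 * q * masterN q F * (G.zab * G.zac) * (u.z0 * u.z0)
      + (1 : ℝ) / 2 * q * masterN q F * (G.zab * G.zac) * (u.z0 * u.zac)
      + (1 : ℝ) / 2 * q * lam F * (G.z0 * G.zac) * (u.zac * u.zbc)
      + (1 : ℝ) / 4 * q * lam F * (G.zab * G.zac) * (u.zac * u.zbc)
      + (1 : ℝ) / 2 * q * kap F * (G.zac * G.zac) * (u.z0 * u.zbc)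
      + (1 : ℝ) / 8 * q * (2 - q) * (F.zac * F.z1) * (G.zab * G.zac) * (u.z0 * u.zbc)
      + (1 : ℝ) / 8 * q ^ 2 * (F.zac * F.z1) * (G.zab * G.zac) * (u.z0 * u.zbc) := by
  simp only [imgAB, wedgeH, fanComboB, fanCombo, conv, edgeAC, edgeBC, detach, V5.total, hx, hy, hz, masterN, kap, lam]
  ring

/-- `(imgAB)_uy ≥ 0` for every MULTIFAN₁ image over `Valid³` (`0 ≤ q ≤ 1`). [folklore] -/
theorem imgAB_uy_nonneg {q : ℝ} {F G u : V5} (hq0 : 0 ≤ q) (hq1 : q ≤ 1) (hF : Valid q F) (hG : Valid q G) (hu : Valid q u) :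
    0 ≤ (imgAB q F G u).uy := by
  obtain ⟨⟨hF0, hFab, hFac, hFbc, hF1⟩, hFN, hFNab, hFNbc, hFL, hFk, hFkb, hFkc⟩ := hF
  obtain ⟨⟨hG0, hGab, hGac, hGbc, hG1⟩, hGN, hGNab, hGNbc, hGL, hGk, hGkb, hGkc⟩ := hG
  obtain ⟨⟨hu0, huab, huac, hubc, hu1⟩, huN, huNab, huNbc, huL, huk, hukb, hukc⟩ := hu
  have hp : 0 ≤ 1 - q := by linarith
  have hr : 0 ≤ 2 - q := by linarith
  rw [imgAB_uy_nonneg_eq]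
  positivity

end ThreeApex

end FK

end Summit.CriticalPhenomena.PercolationContinuityZ3.Theorems
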